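import Literature.AlgebraicGeometry.ShimuraVarieties.UnitaryBallGroupIntegral   -- ★ `map_orbit_haar_eq_smul_bergmanVolume` (Haar ↦ c·dβ under the orbit map)
import Literature.Geometry.ComplexHyperbolic.UnitBallKCentralConeLimit             -- ★ the chart and the blow-up to the sheets `Q = −ε`
import HarnessLib

/-!
# `K`-central orbital integrals of `U(2,1)` against HAAR measure, read in the hyperboloid chart (ROAD A (A3): the group-side packaging)

Topic `Geometry/ComplexHyperbolic`; namespace `Literature.Geometry.ComplexHyperbolic.BallModel`.  THEOREMS ONLY (no `def`, no instance, no notation,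
no axiom, no named fact, no `sorry`).  Cell `pub/hodgecm-mathlib`, ENGINE T1 (crux H413 = `stmt-HodgeConjecture-24833`); floor-1½ preparation, count-neutral,
under row (S-d) ∕ «SdArch» ED. 3 node N1 (`stub_ArchCentralLimitU21`); author F0P3a-p05 (g13), 2026-09-01.  The one-line composition the (A4) assembler consumes:
★ `integral_comp_conj_kCentral_eq_integral_map_orbit` ((A3-a): `K`-central orbital integrals are ball averages along the orbit map) ∘ ★ `map_orbit_haar_eq_smul_bergmanVolume`
(Haar pushes forward to `c·dβ`, `0 < c < ∞`) ∘ ★ `integral_bergmanVolume_pencil_eq_chart` (`dβ = 9·d⁴W`, `P(lift z) = −N(W, √(1+|W|²))`) ∘ ★ `sq_smul_integral_bergmanVolume_pencil_eq_chart`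
(the blow-up `W ↦ √ε·W`).

THE STATEMENTS.  For every Haar measure `μ` on `U(2,1)` (ball model ★ `U21`) there is ONE constant `c > 0` such that for every continuous `Θ : M₃(ℂ) → E` and all `u, v ∈ S¹`:
  **`∫_{U(2,1)} Θ(g·diag(u,u,v)·g⁻¹) dμ(g) = c · ∫_{ℂ²} Θ(u•1 − (v−u)•N(W, √(1+|W|²))) d⁴W`**,
and, for `u ≠ v`, with `ε := |v − u|`, `η := (v−u)∕|v−u|`:
  **`|v−u|² · ∫_{U(2,1)} Θ(g·diag(u,u,v)·g⁻¹) dμ(g) = c · ∫_{ℂ²} Θ(u•1 − η•N(W, √(|v−u| + |W|²))) d⁴W`**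
— the `ε²`-normalised `K`-central orbital integral IS the sheet integral of ★ `UnitBallKCentralConeLimit` ∕ ★ `UnitBallSheetIntegralDeriv` ∕ ★-to-be `UnitBallKCentralSecondOrder`
(leading term, `C²` expansion at the centre `v → u`), with the SAME constant `c` for all `Θ, u, v`.  Note `|v − u|² = 2 − 2 Re(v ū) = 2(1 − cos ψ)` for `v = u e^{iψ}`: this is the factor
`(cos ψ − 1)` of the normal wall jet `N(ρ′Δ)|_{wall} = 4i(cos ψ − 1)`, so `N F_Θ|_{wall}` is EXACTLY `−2ic·(sheet integral)` — no Taylor expansion of the prefactor is needed.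
HONEST LABEL: HC_CM is proved only modulo the printed citations until rung 0 closes; this file is a two-step composition of ★ files and pays nothing by itself.

## References
* [Rogawski1990] J. D. Rogawski, *Automorphic Representations of Unitary Groups in Three Variables*, Ann. of Math. Stud. 123 (1990), §8.4 pp. 126–127.
* [Helgason2000] S. Helgason, *Groups and Geometric Analysis* (2000), Ch. I §1 No. 2, Thm. 1.9 (`∫_G = ∫_{G∕K}∫_K`; uniqueness of the invariant measure on `G∕K`).
* [Goldman1999] W. M. Goldman, *Complex Hyperbolic Geometry* (1999), §3.1.1–3.1.2.
-/

noncomputable section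

open MeasureTheory MeasureTheory.Measure Set Matrix Complex ComplexConjugate Filter Topology
open scoped ENNReal

namespace Literature.Geometry.ComplexHyperbolic.BallModel

variable {E : Type*} [NormedAddCommGroup E] [NormedSpace ℝ E]

/-- **`K`-CENTRAL ORBITAL INTEGRALS AGAINST HAAR MEASURE, IN THE CHART**: for every Haar measure `μ` on `U(2,1)` there is `c > 0` with
`∫_{U(2,1)} Θ(g·diag(u,u,v)·g⁻¹) dμ = c · ∫_{ℂ²} Θ(u•1 − (v−u)•N(W, √(1+|W|²))) d⁴W` for every continuous `Θ` and all `u, v ∈ S¹` (the constant absorbs the `9` of `dβ = 9 d⁴W`).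
[cite: Rogawski1990, §8.4 pp. 126–127] [cite: Helgason2000, Ch. I §1 No. 2, Thm. 1.9] [cite: Goldman1999, §3.1.1] -/
theorem exists_integral_comp_conj_kCentral_eq_smul_integral_chart (μ : Measure U21) [μ.IsHaarMeasure] :
    ∃ c : ℝ, 0 < c ∧ ∀ (Θ : Matrix (Fin 3) (Fin 3) ℂ → E), Continuous Θ → ∀ u v : Circle,
      ∫ g, Θ (mat (g * mkU21 (Matrix.diagonal ![(u : ℂ), u, v]) (diagonal_uuv_preserves u v) * g⁻¹)) ∂μ =
        c • ∫ W : Fin 2 → ℂ, Θ ((u : ℂ) • (1 : Matrix (Fin 3) (Fin 3) ℂ) -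
          ((v : ℂ) - u) • (vecMulVec ![W 0, W 1, (Real.sqrt (1 + nsq W) : ℂ)] (star ![W 0, W 1, (Real.sqrt (1 + nsq W) : ℂ)]) * J)) := by
  obtain ⟨c, hc0, hct, hc⟩ := Literature.AlgebraicGeometry.ShimuraVarieties.BallForms.map_orbit_haar_eq_smul_bergmanVolume μ
  refine ⟨c.toReal * 9, by positivity [ENNReal.toReal_pos hc0 hct], fun Θ hΘ u v => ?_⟩
  rw [integral_comp_conj_kCentral_eq_integral_map_orbit μ Θ hΘ u v, hc, integral_smul_measure, integral_bergmanVolume_pencil_eq_chart, smul_smul]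

/-- THE NORMALISER IS THE WALL JET: for `u, v ∈ S¹`, `|v − u|² = 2 − 2·Re(v ū)` (so for `v = u e^{iψ}` it is `2(1 − cos ψ)`, the factor of the normal jet
`N(ρ′Δ)|_{wall} = 4i(cos ψ − 1)` of the Weyl denominator at the compact wall). [cite: Rogawski1990, §8.4 pp. 126–127] -/
theorem norm_sub_sq_eq_of_circle (u v : Circle) : ‖(v : ℂ) - u‖ ^ 2 = 2 - 2 * ((v : ℂ) * conj (u : ℂ)).re := by
  have hu : Complex.normSq (u : ℂ) = 1 := Circle.normSq_coe u
  have hv : Complex.normSq (v : ℂ) = 1 := Circle.normSq_coe v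
  rw [← Complex.normSq_eq_norm_sq, Complex.normSq_sub, hu, hv]
  ring

/-- **THE `ε²`-NORMALISED `K`-CENTRAL ORBITAL INTEGRAL IS THE SHEET INTEGRAL** (same `c` as above): for `u ≠ v` in `S¹`, with `ε = |v−u| > 0` and `η = (v−u)∕|v−u|`,
`|v−u|² · ∫_{U(2,1)} Θ(g·diag(u,u,v)·g⁻¹) dμ = c · ∫_{ℂ²} Θ(u•1 − η•N(W, √(|v−u| + |W|²))) d⁴W` (★ `sq_smul_integral_bergmanVolume_pencil_eq_chart` with `εη = v − u`).
[cite: Rogawski1990, §8.4 pp. 126–127] [cite: Goldman1999, §3.1.1] -/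
theorem exists_sq_smul_integral_comp_conj_kCentral_eq_smul_integral_sheet (μ : Measure U21) [μ.IsHaarMeasure] :
    ∃ c : ℝ, 0 < c ∧ ∀ (Θ : Matrix (Fin 3) (Fin 3) ℂ → E), Continuous Θ → ∀ u v : Circle, u ≠ v →
      ‖(v : ℂ) - u‖ ^ 2 • (∫ g, Θ (mat (g * mkU21 (Matrix.diagonal ![(u : ℂ), u, v]) (diagonal_uuv_preserves u v) * g⁻¹)) ∂μ) =
        c • ∫ W : Fin 2 → ℂ, Θ ((u : ℂ) • (1 : Matrix (Fin 3) (Fin 3) ℂ) -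
          (((v : ℂ) - u) / ((‖(v : ℂ) - u‖ : ℝ) : ℂ)) • (vecMulVec ![W 0, W 1, (Real.sqrt (‖(v : ℂ) - u‖ + nsq W) : ℂ)]
            (star ![W 0, W 1, (Real.sqrt (‖(v : ℂ) - u‖ + nsq W) : ℂ)]) * J)) := by
  obtain ⟨c, hc0, hct, hc⟩ := Literature.AlgebraicGeometry.ShimuraVarieties.BallForms.map_orbit_haar_eq_smul_bergmanVolume μ
  refine ⟨c.toReal * 9, by positivity [ENNReal.toReal_pos hc0 hct], fun Θ hΘ u v huv => ?_⟩
  have hε : 0 < ‖(v : ℂ) - u‖ := norm_pos_iff.2 (sub_ne_zero.2 fun h => huv (Circle.ext h).symm)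
  have hεne : ((‖(v : ℂ) - u‖ : ℝ) : ℂ) ≠ 0 := by exact_mod_cast hε.ne'
  have hprod : ((‖(v : ℂ) - u‖ : ℝ) : ℂ) * (((v : ℂ) - u) / ((‖(v : ℂ) - u‖ : ℝ) : ℂ)) = (v : ℂ) - u := mul_div_cancel₀ _ hεne
  have key := sq_smul_integral_bergmanVolume_pencil_eq_chart Θ (u : ℂ) (((v : ℂ) - u) / ((‖(v : ℂ) - u‖ : ℝ) : ℂ)) hε
  rw [hprod] at key
  rw [integral_comp_conj_kCentral_eq_integral_map_orbit μ Θ hΘ u v, hc, integral_smul_measure, smul_comm, key, smul_smul]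

end Literature.Geometry.ComplexHyperbolic.BallModel

end
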